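import Summits.RiemannHypothesis.RiemannHypothesis.Theses.LaguerreSpeiserSplit
import Summits.RiemannHypothesis.RiemannHypothesis.Theorems.UniversalFactorLaguerreLift
import Summits.RiemannHypothesis.RiemannHypothesis.Theorems.Splittings.JensenX4RowsFromOneXiPrime
import Summits.RiemannHypothesis.RiemannHypothesis.Theorems.Splittings.JensenX4NewmanDict
import Literature.NumberTheory.LFunctions.RodgersTaoZeroSet
import Literature.NumberTheory.LFunctions.RiemannXiProofs
import Literature.NumberTheory.LFunctions.ZetaLogDerivSeries
import Literature.Analysis.Complex.JensenCircles
import Literature.Analysis.Complex.FourierPolyaKiKimEngine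
import HarnessLib

/-!
# Laguerre–Pólya heredity for `Ξ′`: the support item `LaguerreSpeiserSplit.LaguerreHeredityOfXiPrime`
# (stmt-RiemannHypothesis-18898) — route `LaguerreSpeiserSplit` then closes from its two cruxes alone

Cell rh-split, seat rh-splitx-theory-1 g3 (batch 4 §13.10; scratch file `T15LaguerreHeredity.lean` sha16
5c1a5ba9c8b5e5b9 = sections A–D of `T17SplitCensus.lean`), placed by rh-split-lead g3 RULING #45/#45a as lane (xvii)
file 1 of 2; filed by a typer after the referee's replay/read-back.  Verbatim decl bodies; namespace
`Scratch.SplitxTheory1G3c` ↦ `Theorems.Splittings.JensenX4LaguerreHeredity`; three helpers with landed twins made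
`private` (`differentiable_Xi` ≡ `Theorems.SoloInformedGroundStateLimit.differentiable_riemannXiUpper'`,
`Xi_zero_ne` ≡ `ThinRigidity.riemannXiUpper_zero_ne_zero`, `im_Xi_ofReal` = an instance of
`im_riemannXiUpper_ofReal_holds`) to keep the import cone small.
HONEST LABEL: «SPLITTING SEARCH over kernel-typed RH-EQUIVALENCES; a splitting A ∧ B ⟹ RH is CONDITIONAL
bookkeeping unless A and B are both proved; nothing here bears on the truth of RH.»

Zero definitions, zero `sorry`.  Content: (A) `Ξ` is entire, real on `ℝ`, of growth `exp(‖z‖^{7/4})`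
(`norm_xiSq_le`, `riemannXiUpper_eq_xiSq`), has infinitely many zeros (`infinite_setOf_deBruijnH_eq_zero 0`,
`deBruijnH_zero_eq_xiSq`: `H₀(2z) = Ξ(z)/8`), `Ξ(0) ≠ 0`; (B) no `Ξ^{(m)}` vanishes identically (Taylor at `0` +
`Polynomial.eq_zero_of_infinite_isRoot`), every `Ξ^{(m)}` is real entire of order `< 2`
(`Literature.Analysis.Complex.exists_growth_iteratedDeriv`), and `XiPrimeOnLine ⟹` all zeros of `Ξ^{(m+1)}`
real (Hadamard-free Laguerre step `UniversalFactor.laguerre_step`, `c = 0`); (C) the generic strict Laguerre sign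
`laguerre_sign` at real critical points of a real entire function of order `< 2` with only real zeros and
`f′ ≢ 0` (vertical slice of `Im (f′/f)`, `im_mul_im_logDeriv_le`, slope limit); (D) the item, via
`KiKim.iteratedDeriv_re_ofReal`, the read-back `XiPrimeOnLine → LaguerreOnLine → RiemannHypothesis`
(`LaguerreSpeiserSplit.closes` with the item discharged), and the route's assembly item (stmt-RiemannHypothesis-18899,
whose type is `closes`' own).  Sources: Ki–Kim, Duke Math. J. 104 (2000) §4;
Craven–Csordas–Smith, Ann. Math. 125 (1987) §1 (Laguerre inequalities); Levin, Distribution of zeros, Ch. VIII.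
-/

set_option linter.dupNamespace false

noncomputable section

namespace Summit.RiemannHypothesis.RiemannHypothesis.Theorems.Splittings.JensenX4LaguerreHeredity

open Literature.NumberTheory.LFunctions Literature.Analysis.Complex
open scoped Real Topology

/-! ## A. Facts about `Ξ = riemannXiUpper` -/

/-- `Ξ` is entire (private twin of the landed `Theorems.SoloInformedGroundStateLimit.differentiable_riemannXiUpper'`,
kept local to avoid that file's import cone; downstream use `(Xi_level 0).1`). -/
private theorem differentiable_Xi : Differentiable ℂ riemannXiUpper := by
  have h : riemannXiUpper = fun w ↦ xiSq (-(w ^ 2)) :=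
    funext Theorems.Splittings.JensenX4RowsFromOneXiPrime.riemannXiUpper_eq_xiSq
  rw [h]
  exact differentiable_xiSq.comp ((differentiable_id.pow 2).neg)

/-- `Ξ` is real on the real axis (instance of the landed fact `im_riemannXiUpper_ofReal_holds`; downstream use
`(Xi_level 0).2.1`). -/
private theorem im_Xi_ofReal (x : ℝ) : (riemannXiUpper x).im = 0 := im_riemannXiUpper_ofReal_holds x

/-- `Ξ` has order `< 2` quantitatively: `‖Ξ z‖ ≤ C · exp (‖z‖ ^ (7/4))`. -/
theorem exists_growth_Xi :
    ∃ C : ℝ, ∀ z : ℂ, ‖riemannXiUpper z‖ ≤ C * Real.exp (‖z‖ ^ (7 / 4 : ℝ)) := by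
  obtain ⟨C, hC⟩ := norm_xiSq_le
  refine ⟨C, fun z ↦ ?_⟩
  rw [Theorems.Splittings.JensenX4RowsFromOneXiPrime.riemannXiUpper_eq_xiSq]
  have h := hC (-(z ^ 2))
  have hn : ‖-(z ^ 2)‖ ^ (7 / 8 : ℝ) = ‖z‖ ^ (7 / 4 : ℝ) := by
    rw [norm_neg, norm_pow, ← Real.rpow_natCast, ← Real.rpow_mul (norm_nonneg z)]
    norm_num
  rwa [hn] at h

/-- `Ξ` has infinitely many zeros (from the tree's `H_0` version and `H_0(2z) = Ξ(z)/8`). -/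
theorem infinite_setOf_Xi_eq_zero : {z : ℂ | riemannXiUpper z = 0}.Infinite := by
  have hH := infinite_setOf_deBruijnH_eq_zero 0
  have himg : (fun w : ℂ ↦ w / 2) '' {w : ℂ | deBruijnH 0 w = 0} ⊆ {z : ℂ | riemannXiUpper z = 0} := by
    rintro z ⟨w, hw, rfl⟩
    simp only [Set.mem_setOf_eq] at hw ⊢
    rw [Theorems.Splittings.JensenX4NewmanDict.deBruijnH_zero_eq_xiSq] at hw
    rw [Theorems.Splittings.JensenX4RowsFromOneXiPrime.riemannXiUpper_eq_xiSq]
    have : -((w / 2) ^ 2) = -(w ^ 2 / 4) := by ring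
    rw [this]
    simpa using hw
  refine Set.Infinite.mono himg (hH.image ?_)
  intro a _ b _ hab
  simpa using hab

/-- `Ξ(0) ≠ 0` (private twin of the landed `ThinRigidity.riemannXiUpper_zero_ne_zero` of `HandoffThinRigidity`,
kept local to avoid that import). -/
private theorem Xi_zero_ne : riemannXiUpper 0 ≠ 0 := by
  rw [Theorems.Splittings.JensenX4RowsFromOneXiPrime.riemannXiUpper_eq_xiSq]
  simpa using xiSq_zero_ne

/-! ## B. No derivative of `Ξ` vanishes identically; all zeros of `Ξ^{(m)}`, `m ≥ 1`, real -/

/-- An entire function with infinitely many zeros, not identically zero, has no identically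
vanishing iterated derivative (else, by Taylor at `0`, it is a polynomial). [folklore] -/
theorem exists_iteratedDeriv_ne_zero_of_infinite {f : ℂ → ℂ} (hf : Differentiable ℂ f)
    (h0 : ∃ z, f z ≠ 0) (hinf : {z : ℂ | f z = 0}.Infinite) (m : ℕ) :
    ∃ z, iteratedDeriv m f z ≠ 0 := by
  by_contra h
  push Not at h
  have hvan : ∀ n, m ≤ n → iteratedDeriv n f 0 = 0 := by
    intro n hn
    obtain ⟨j, rfl⟩ := Nat.exists_eq_add_of_le hn
    have hm : deriv^[m] f = fun _ ↦ (0 : ℂ) := by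
      funext w; have := h w; rwa [iteratedDeriv_eq_iterate] at this
    rw [iteratedDeriv_eq_iterate, add_comm, Function.iterate_add_apply, hm,
      ← iteratedDeriv_eq_iterate, iteratedDeriv_const]
    simp
  set p : Polynomial ℂ :=
    ∑ n ∈ Finset.range m, Polynomial.C ((n.factorial : ℂ)⁻¹ * iteratedDeriv n f 0) * Polynomial.X ^ n
    with hp
  have hfp : ∀ z, f z = p.eval z := by
    intro z
    have ht := Complex.taylorSeries_eq_of_entire' (c := 0) (z := z) hf
    rw [← ht, tsum_eq_sum (s := Finset.range m)]
    · simp [hp, Polynomial.eval_finsetSum]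
    · intro n hn
      simp only [Finset.mem_range, not_lt] at hn
      simp [hvan n hn]
  have hp0 : p = 0 := by
    apply Polynomial.eq_zero_of_infinite_isRoot
    refine hinf.mono fun z hz ↦ ?_
    simp only [Set.mem_setOf_eq] at hz ⊢
    rw [Polynomial.IsRoot.def, ← hfp]
    exact hz
  obtain ⟨z, hz⟩ := h0
  exact hz (by rw [hfp, hp0, Polynomial.eval_zero])

/-- No iterated derivative `Ξ^{(m)}` vanishes identically (`Ξ` is not a polynomial). -/
theorem exists_iteratedDeriv_Xi_ne_zero (m : ℕ) : ∃ z, iteratedDeriv m riemannXiUpper z ≠ 0 :=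
  exists_iteratedDeriv_ne_zero_of_infinite differentiable_Xi ⟨0, Xi_zero_ne⟩
    infinite_setOf_Xi_eq_zero m

/-- Abbreviation-free bundle: `Ξ^{(m)}` is entire, real on `ℝ`, of order `< 2`. -/
theorem Xi_level (m : ℕ) :
    Differentiable ℂ (iteratedDeriv m riemannXiUpper) ∧
    (∀ x : ℝ, (iteratedDeriv m riemannXiUpper x).im = 0) ∧
    ∃ ρ C : ℝ, 0 ≤ ρ ∧ ρ < 2 ∧
      ∀ z, ‖iteratedDeriv m riemannXiUpper z‖ ≤ C * Real.exp (‖z‖ ^ ρ) := by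
  obtain ⟨C, hC⟩ := exists_growth_Xi
  exact ⟨differentiable_iteratedDeriv_of_entire differentiable_Xi m,
    im_iteratedDeriv_ofReal differentiable_Xi im_Xi_ofReal m,
    exists_growth_iteratedDeriv differentiable_Xi (by norm_num) (by norm_num) hC m⟩

/-- **Heredity of real zeros (Laguerre).** If every zero of `Ξ′` is real, then every zero of
`Ξ^{(m+1)}` is real, for every `m`. -/
theorem zeros_real_iteratedDeriv (hA : Theses.LaguerreSpeiserSplit.XiPrimeOnLine) (m : ℕ) :
    ∀ z, iteratedDeriv (m + 1) riemannXiUpper z = 0 → z.im = 0 := by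
  induction m with
  | zero =>
    intro z hz
    rw [zero_add, iteratedDeriv_one] at hz
    exact hA z hz
  | succ m ih =>
    obtain ⟨hd, hreal, ρ, C, hρ0, hρ, hgr⟩ := Xi_level (m + 1)
    rcases Theorems.UniversalFactor.laguerre_step hd hρ0 hρ hgr hreal ih 0 with h | h
    · exfalso
      obtain ⟨z, hz⟩ := exists_iteratedDeriv_Xi_ne_zero (m + 1 + 1)
      apply hz
      rw [iteratedDeriv_succ]
      simpa using h z
    · intro z hz
      apply h z
      rw [iteratedDeriv_succ] at hz
      simp [hz]

/-! ## C. The strict Laguerre sign at real critical points (generic engine) -/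

/-- **Strict Laguerre sign at a critical point.** Let `f` be entire, of order `< 2`
quantitatively, real on `ℝ`, with only real zeros and `f′ ≢ 0`. If `x ∈ ℝ` has `f′(x) = 0` and
`f(x) ≠ 0`, then `f(x) · f″(x) < 0`. Proof: `f` has a zero `a` (else `f′/f` is a real constant,
`= 0` at `x`, so `f′ ≡ 0`); with `q := f′/f`, `q(x) = 0`, `q′(x) = f″(x)/f(x)`, and along the
vertical line `y ↦ Im q(x+iy)` has slope `Re q′(x)` at `0` while
`Im q(x+iy)/y ≤ -1/‖x+iy-a‖²` (`im_mul_im_logDeriv_le`), whence `q′(x) ≤ -1/(‖x-a‖+1)² < 0`.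
[folklore; Laguerre's inequality in the Laguerre–Pólya class] -/
theorem laguerre_sign {f : ℂ → ℂ} (hf : Differentiable ℂ f) {ρ C : ℝ} (hρ0 : 0 ≤ ρ)
    (hρ : ρ < 2) (hgr : ∀ z, ‖f z‖ ≤ C * Real.exp (‖z‖ ^ ρ)) (hreal : ∀ x : ℝ, (f x).im = 0)
    (hzero : ∀ z, f z = 0 → z.im = 0) (hnc : ∃ z, deriv f z ≠ 0) (x : ℝ)
    (hx1 : deriv f x = 0) (hx0 : f x ≠ 0) :
    (f x).re * (deriv (deriv f) x).re < 0 := by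
  have hd : Differentiable ℂ (deriv f) := by
    simpa [iteratedDeriv_one] using differentiable_iteratedDeriv_of_entire hf 1
  -- Step 1: `f` has a zero.
  have hex : ∃ a, f a = 0 := by
    by_contra hne
    push Not at hne
    have him : ∀ w, (deriv f w / f w).im = 0 :=
      im_logDeriv_eq_zero_of_forall_ne_zero hf hρ0 hρ hgr hreal hne
    have hq : Differentiable ℂ (fun w ↦ deriv f w / f w) := hd.div hf hne
    obtain ⟨c, hc⟩ := (hq.differentiableOn.analyticOnNhd isOpen_univ).eq_const_of_im_eq_const
      (fun w _ ↦ him w) isOpen_univ isConnected_univ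
    have hdf : ∀ w, deriv f w = c * f w := fun w ↦
      (div_eq_iff (hne w)).1 (hc w (Set.mem_univ w))
    have hc0 : c = 0 := by
      have h1 := hdf x
      rw [hx1] at h1
      exact (mul_eq_zero.1 h1.symm).resolve_right (hne x)
    obtain ⟨w, hw⟩ := hnc
    exact hw (by rw [hdf w, hc0, zero_mul])
  obtain ⟨a, ha⟩ := hex
  have ha_im : a.im = 0 := hzero a ha
  -- Step 2: the logarithmic derivative `q` near `x`.
  set q : ℂ → ℂ := fun w ↦ deriv f w / f w with hq_def
  have hqx : DifferentiableAt ℂ q x := (hd.differentiableAt).div (hf.differentiableAt) hx0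
  have hdq : deriv q x = deriv (deriv f) x / f x := by
    have hq' : q = deriv f / f := by rw [hq_def]; rfl
    rw [hq', deriv_div hd.differentiableAt hf.differentiableAt hx0, hx1]
    field_simp
    ring
  -- Step 3: the vertical slice `φ(y) = Im q(x + iy)` and its slope at `0`.
  set h : ℂ → ℂ := fun w ↦ q ((x : ℂ) + Complex.I * w) with hh_def
  have hlin : HasDerivAt (fun w : ℂ ↦ (x : ℂ) + Complex.I * w) Complex.I 0 := by
    simpa using ((hasDerivAt_id (0 : ℂ)).const_mul Complex.I).const_add (x : ℂ)
  have hqx' : HasDerivAt q (deriv q x) ((x : ℂ) + Complex.I * 0) := by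
    simpa using hqx.hasDerivAt
  have hh : HasDerivAt h (deriv q x * Complex.I) 0 := by
    rw [hh_def]
    exact (hqx'.comp 0 hlin :)
  have hh0 : DifferentiableAt ℂ h ((0 : ℝ) : ℂ) := by
    rw [Complex.ofReal_zero]; exact hh.differentiableAt
  have hφ' : HasDerivAt (fun s : ℝ ↦ (h s).im) (deriv q x).re 0 := by
    have := KiKim.hasDerivAt_im_ofReal hh0
    rw [Complex.ofReal_zero, hh.deriv] at this
    simpa using this
  have hφ0 : (h ((0 : ℝ) : ℂ)).im = 0 := by
    simp [hh_def, hq_def, hx1]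
  have hT := hφ'.tendsto_slope_zero_right
  -- Step 4: the bound along the slice.
  set R : ℝ := ‖(x : ℂ) - a‖ + 1 with hR
  have hRpos : 0 < R := by positivity
  have hbound : ∀ᶠ t in 𝓝[>] (0 : ℝ),
      t⁻¹ • ((fun s : ℝ ↦ (h s).im) (0 + t) - (fun s : ℝ ↦ (h s).im) 0) ≤ -(1 / R ^ 2) := by
    filter_upwards [Ioo_mem_nhdsGT (zero_lt_one' ℝ)] with t ht
    obtain ⟨ht0, ht1⟩ := ht
    simp only [zero_add, smul_eq_mul]
    rw [hφ0, sub_zero]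
    set z : ℂ := (x : ℂ) + Complex.I * t with hz
    have hzim : z.im = t := by simp [hz]
    have hzim' : z.im ≠ 0 := by rw [hzim]; exact ht0.ne'
    have key := im_mul_im_logDeriv_le hf hρ0 hρ hgr hreal hzero hzim' ha
    rw [hzim] at key
    have hhz : h t = deriv f z / f z := by simp [hh_def, hq_def, hz]
    rw [hhz]
    have hza_pos : 0 < ‖z - a‖ := by
      rw [norm_pos_iff, sub_ne_zero]
      intro hza; rw [hza, ha_im] at hzim; exact ht0.ne hzim
    have hza_le : ‖z - a‖ ≤ R := by
      calc ‖z - a‖ = ‖((x : ℂ) - a) + Complex.I * t‖ := by rw [hz]; ring_nf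
        _ ≤ ‖(x : ℂ) - a‖ + ‖Complex.I * (t : ℂ)‖ := norm_add_le _ _
        _ ≤ ‖(x : ℂ) - a‖ + 1 := by
            gcongr
            rw [norm_mul, Complex.norm_I, one_mul, Complex.norm_real, Real.norm_eq_abs,
              abs_of_pos ht0]
            exact ht1.le
    have hN : 0 < ‖z - a‖ ^ 2 := by positivity
    have h1 : t⁻¹ * (deriv f z / f z).im ≤ -(1 / ‖z - a‖ ^ 2) := by
      rw [inv_mul_le_iff₀ ht0]
      refine le_of_mul_le_mul_left ?_ ht0
      calc t * (deriv f z / f z).im ≤ -(t ^ 2 / ‖z - a‖ ^ 2) := key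
        _ = t * (t * -(1 / ‖z - a‖ ^ 2)) := by ring
    have h2 : -(1 / ‖z - a‖ ^ 2) ≤ -(1 / R ^ 2) := by
      apply neg_le_neg
      apply one_div_le_one_div_of_le hN
      exact pow_le_pow_left₀ hza_pos.le hza_le 2
    exact h1.trans h2
  -- Step 5: the limit `y → 0⁺` and the sign of `f(x) f″(x)`.
  have hlim : (deriv q x).re ≤ -(1 / R ^ 2) := le_of_tendsto hT hbound
  have hneg : (deriv q x).re < 0 := by
    have : 0 < 1 / R ^ 2 := by positivity
    linarith
  have hv_im : (deriv (deriv f) x).im = 0 := by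
    have := im_iteratedDeriv_ofReal hf hreal 2 x
    rwa [show (2 : ℕ) = 1 + 1 from rfl, iteratedDeriv_succ, iteratedDeriv_one] at this
  set u : ℝ := (f x).re with hu_def
  set v : ℝ := (deriv (deriv f) x).re with hv_def
  have hu : f x = (u : ℂ) := Complex.ext (by simp [hu_def]) (by simp [hreal x])
  have hv : deriv (deriv f) x = (v : ℂ) := Complex.ext (by simp [hv_def]) (by simp [hv_im])
  have hre : (deriv q x).re = v / u := by
    rw [hdq, hu, hv, ← Complex.ofReal_div, Complex.ofReal_re]
  have hu0 : u ≠ 0 := fun h0 ↦ hx0 (by rw [hu, h0]; simp)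
  have hvu : v / u < 0 := hre ▸ hneg
  have huv : u * v = v / u * u ^ 2 := by field_simp
  rw [huv]
  exact mul_neg_of_neg_of_pos hvu (by positivity)

/-! ## D. The support item of route `LaguerreSpeiserSplit` (stmt-RiemannHypothesis-18898) -/

/-- At every level `m ≥ 1`: at a real critical point `c` of `Ξ^{(m)}` with `Ξ^{(m)}(c) ≠ 0`,
`Re Ξ^{(m)}(c) · Re Ξ^{(m+2)}(c) < 0`, provided every zero of `Ξ′` is real. -/
theorem laguerre_sign_Xi_level (hA : Theses.LaguerreSpeiserSplit.XiPrimeOnLine) (m : ℕ) (c : ℝ)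
    (h1 : (iteratedDeriv (m + 1 + 1) riemannXiUpper c).re = 0)
    (h0 : (iteratedDeriv (m + 1) riemannXiUpper c).re ≠ 0) :
    (iteratedDeriv (m + 1) riemannXiUpper c).re *
      (iteratedDeriv (m + 1 + 1 + 1) riemannXiUpper c).re < 0 := by
  obtain ⟨hd, hreal, ρ, C, hρ0, hρ, hgr⟩ := Xi_level (m + 1)
  have hreal2 := (Xi_level (m + 1 + 1)).2.1
  have hx1 : deriv (iteratedDeriv (m + 1) riemannXiUpper) c = 0 := by
    rw [← iteratedDeriv_succ]
    exact Complex.ext (by simpa using h1) (by simpa using hreal2 c)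
  have hx0 : iteratedDeriv (m + 1) riemannXiUpper c ≠ 0 := fun h ↦ h0 (by rw [h]; simp)
  have hnc : ∃ z, deriv (iteratedDeriv (m + 1) riemannXiUpper) z ≠ 0 := by
    rw [← iteratedDeriv_succ]
    exact exists_iteratedDeriv_Xi_ne_zero (m + 1 + 1)
  have key := laguerre_sign hd hρ0 hρ hgr hreal (zeros_real_iteratedDeriv hA m) hnc c hx1 hx0
  rwa [← iteratedDeriv_succ, ← iteratedDeriv_succ] at key

/-- **The support item `LaguerreHeredityOfXiPrime` (stmt-RiemannHypothesis-18898) holds**: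
if every zero of `Ξ′` is real, then `t ↦ Re Ξ′(t)` has no critical points in the sense of
Fourier–Ki–Kim (the strict Laguerre sign at every level). -/
theorem laguerreHeredityOfXiPrime : Theses.LaguerreSpeiserSplit.LaguerreHeredityOfXiPrime := by
  intro hA l c h1 h0
  have hF1d : Differentiable ℂ (deriv riemannXiUpper) := by
    simpa [iteratedDeriv_one] using differentiable_iteratedDeriv_of_entire differentiable_Xi 1
  have hg : ∀ n, iteratedDeriv n (fun t : ℝ ↦ (deriv riemannXiUpper (t : ℂ)).re) =
      fun t : ℝ ↦ (iteratedDeriv (n + 1) riemannXiUpper (t : ℂ)).re := by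
    intro n
    rw [KiKim.iteratedDeriv_re_ofReal hF1d n, iteratedDeriv_succ']
  simp only [hg] at h1 h0 ⊢
  exact laguerre_sign_Xi_level hA l c h1 h0

/-- Read-back in the served route's own terms: with the support item discharged, the route
`LaguerreSpeiserSplit` closes from its two cruxes alone. -/
theorem rh_of_xiPrimeOnLine_of_laguerreOnLine
    (hA : Theses.LaguerreSpeiserSplit.XiPrimeOnLine) (hB : Theses.LaguerreSpeiserSplit.LaguerreOnLine) :
    _root_.Summit.RiemannHypothesis :=
  Theses.LaguerreSpeiserSplit.closes hA hB laguerreHeredityOfXiPrime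

/-- **Route `LaguerreSpeiserSplit`'s assembly item (stmt-RiemannHypothesis-18899)** — its type is literally the
route's deciding theorem `closes`; recorded here so the ledger item closes by type match. -/
theorem laguerreSpeiserSplit_assembly : Theses.LaguerreSpeiserSplit.Assembly :=
  Theses.LaguerreSpeiserSplit.closes

end Summit.RiemannHypothesis.RiemannHypothesis.Theorems.Splittings.JensenX4LaguerreHeredity

end
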